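import Mathlib
import HarnessLib
import Summits.HubbardSuperconductivity.HubbardSuperconductivity.Theorems.KLProgrammeH10TwoPointLimitSymbolAngularFactor

/-!
# Route `KLProgramme` — engine support, route (L2) symbol layer for the FAT sector family: the angular factor of the fat pair
# `F̃_ω·F̃_{ω′}` — a DOUBLE SUM of the p4 lineage's two-sector angular factors — smooth, `≤ 1`, supported in the union of cells, vanishing
# beyond the zone, with line derivatives `|S₁|·|S₂|` times the two-sector bounds

Cell `gate-hubbard-kl`, seat hubbard-kl-k3c2-p3; gen-4 ENGINE child stmt-HubbardSuperconductivity-19855 (`stub_engine_step_norms`, propagator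
`α_n`).  The single-scale step theorem `hubbardSectorKernelNorm_effAction_le_of_sectorNorm` pulls the slice covariance back by the FAT family
`Ft` (`bgmFatMultiplier`: scale plateau `C_{h+1}⁻¹` times the angular plateau `Σ_{a ∈ S_ω} ζ̃_{n,a}`, `S_ω` = the three neighbours of `ω`), so
the multiplier product of `slicePair_charSum_l1_le` is `Ft_ω·Ft_{ω′}`.  Its angular factor (with the square cutoff and the radial plateau of
`…SymbolAngularFactor`, invisible at the samples) is, for index sets `S₁, S₂ ⊆ range N`,
`Z(p) = χ_sq(p₀²)χ_sq(p₁²)·(R(p)Σ_{a∈S₁}ζ̃_{n,a}(θp))·(R(p)Σ_{b∈S₂}ζ̃_{n,b}(θp)) = Σ_{a∈S₁}Σ_{b∈S₂} Z_{ab}(p)` with `Z_{ab}` the two-sector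
factor of the p4 lineage at `(n,a),(n,b)`.  Proved (hypothesis `hZ` = the formula):

* `fatAngular_eq_sum`; `contDiff_fatAngularFormula` (stated on the explicit formula; rewrite with `funext hZ`); `abs_fatAngular_le_one` (partition of unity:
  `Σ_{a∈S}ζ̃_{n,a} ≤ 1` for `S ⊆ range N`);
* `fatAngular_support` (`Z p ≠ 0 ⇒ ∃ a ∈ S₁, ζ̃_{n,a}(θp) ≠ 0`), `abs_lt_of_fatAngular_ne_zero` (zone, contrapositive form);
* **`abs_derivs_fatAngular_line_le`** — at a point of the open square with `‖·‖ ≥ 1`: `|∂ₛZ| ≤ |S₁||S₂|·4B·D`,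
  `|∂ₛ²Z| ≤ |S₁||S₂|·(4B·D² + 8B²·D²)`, `D = (1 + 2/w_n)‖w₁ + iw₂‖`.

Everything is proved; no definitions, no named facts. [folklore]

References: G. Benfatto, A. Giuliani, V. Mastropietro, Ann. Henri Poincaré 7 (2006) 809–898, §2.5 (2.45)–(2.46), §2.7 (2.66), (2.71a).
-/

noncomputable section

namespace Summit.HubbardSuperconductivity.HubbardSuperconductivity.Theorems.TorusFourierL2

set_option linter.dupNamespace false -- summit = problem name (single-conjunct summit), D-0017

open Set Finset Filter Topology Complex Literature.MathematicalPhysics.QuantumLattice Literature.Analysis.SpecialFunctions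
open scoped Real Nat

section Fat

variable {z : ℝ} {n : ℕ} {S₁ S₂ : Finset ℕ} {Z : (Fin 2 → ℝ) → ℝ}
  (hZ : ∀ p, Z p = gnCutoff ((π + z) ^ 2 / π ^ 2) ((π + z) ^ 2) (p 0 ^ 2) * gnCutoff ((π + z) ^ 2 / π ^ 2) ((π + z) ^ 2) (p 1 ^ 2) *
    ((radialCutoffC (1 / 2) (momToComplex p) * ∑ a ∈ S₁, sectorWeightCirc n ((a : ℕ) : ℤ) (polarAngle p)) *
      (radialCutoffC (1 / 2) (momToComplex p) * ∑ b ∈ S₂, sectorWeightCirc n ((b : ℕ) : ℤ) (polarAngle p))))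
include hZ

/-- **The fat angular factor is the double sum of two-sector angular factors.** [folklore] -/
theorem fatAngular_eq_sum (p : Fin 2 → ℝ) :
    Z p = ∑ a ∈ S₁, ∑ b ∈ S₂,
      gnCutoff ((π + z) ^ 2 / π ^ 2) ((π + z) ^ 2) (p 0 ^ 2) * gnCutoff ((π + z) ^ 2 / π ^ 2) ((π + z) ^ 2) (p 1 ^ 2) *
        ((radialCutoffC (1 / 2) (momToComplex p) * sectorWeightCirc n ((a : ℕ) : ℤ) (polarAngle p)) *
          (radialCutoffC (1 / 2) (momToComplex p) * sectorWeightCirc n ((b : ℕ) : ℤ) (polarAngle p))) := by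
  rw [hZ, mul_sum, mul_sum, sum_mul_sum, mul_sum]
  refine sum_congr rfl fun a _ => ?_
  rw [mul_sum]

omit hZ in
/-- **The fat angular factor (explicit formula) is smooth on all of `ℝ²`.** [folklore] -/
theorem contDiff_fatAngularFormula (z : ℝ) (n : ℕ) (S₁ S₂ : Finset ℕ) {m : ℕ∞} :
    ContDiff ℝ m fun p : Fin 2 → ℝ =>
      gnCutoff ((π + z) ^ 2 / π ^ 2) ((π + z) ^ 2) (p 0 ^ 2) * gnCutoff ((π + z) ^ 2 / π ^ 2) ((π + z) ^ 2) (p 1 ^ 2) *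
        ((radialCutoffC (1 / 2) (momToComplex p) * ∑ a ∈ S₁, sectorWeightCirc n ((a : ℕ) : ℤ) (polarAngle p)) *
          (radialCutoffC (1 / 2) (momToComplex p) * ∑ b ∈ S₂, sectorWeightCirc n ((b : ℕ) : ℤ) (polarAngle p))) := by
  have hfun : (fun p : Fin 2 → ℝ =>
      gnCutoff ((π + z) ^ 2 / π ^ 2) ((π + z) ^ 2) (p 0 ^ 2) * gnCutoff ((π + z) ^ 2 / π ^ 2) ((π + z) ^ 2) (p 1 ^ 2) *
        ((radialCutoffC (1 / 2) (momToComplex p) * ∑ a ∈ S₁, sectorWeightCirc n ((a : ℕ) : ℤ) (polarAngle p)) *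
          (radialCutoffC (1 / 2) (momToComplex p) * ∑ b ∈ S₂, sectorWeightCirc n ((b : ℕ) : ℤ) (polarAngle p)))) =
      fun p => ∑ a ∈ S₁, ∑ b ∈ S₂,
        gnCutoff ((π + z) ^ 2 / π ^ 2) ((π + z) ^ 2) (p 0 ^ 2) * gnCutoff ((π + z) ^ 2 / π ^ 2) ((π + z) ^ 2) (p 1 ^ 2) *
          ((radialCutoffC (1 / 2) (momToComplex p) * sectorWeightCirc n ((a : ℕ) : ℤ) (polarAngle p)) *
            (radialCutoffC (1 / 2) (momToComplex p) * sectorWeightCirc n ((b : ℕ) : ℤ) (polarAngle p))) :=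
    funext (fatAngular_eq_sum (Z := fun p : Fin 2 → ℝ =>
      gnCutoff ((π + z) ^ 2 / π ^ 2) ((π + z) ^ 2) (p 0 ^ 2) * gnCutoff ((π + z) ^ 2 / π ^ 2) ((π + z) ^ 2) (p 1 ^ 2) *
        ((radialCutoffC (1 / 2) (momToComplex p) * ∑ a ∈ S₁, sectorWeightCirc n ((a : ℕ) : ℤ) (polarAngle p)) *
          (radialCutoffC (1 / 2) (momToComplex p) * ∑ b ∈ S₂, sectorWeightCirc n ((b : ℕ) : ℤ) (polarAngle p)))) (fun _ => rfl))
  rw [hfun]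
  refine ContDiff.sum fun a _ => ContDiff.sum fun b _ => ?_
  exact contDiff_angularFactor (n₁ := n) (n₂ := n) (ω₁ := ((a : ℕ) : ℤ)) (ω₂ := ((b : ℕ) : ℤ)) (z := z) (fun _ => rfl)

omit hZ in
/-- A sub-sum of the angular partition of unity is in `[0, 1]`. [cite: BenfattoGiulianiMastropietro2006, §2.5 (2.45)] -/
theorem sum_sectorWeightCirc_sub_mem {S : Finset ℕ} (hS : S ⊆ range (sectorCount n)) (θ : ℝ) :
    0 ≤ ∑ a ∈ S, sectorWeightCirc n ((a : ℕ) : ℤ) θ ∧ ∑ a ∈ S, sectorWeightCirc n ((a : ℕ) : ℤ) θ ≤ 1 := by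
  refine ⟨sum_nonneg fun a _ => sectorWeightCirc_nonneg _ _ _, ?_⟩
  calc ∑ a ∈ S, sectorWeightCirc n ((a : ℕ) : ℤ) θ ≤ ∑ a ∈ range (sectorCount n), sectorWeightCirc n ((a : ℕ) : ℤ) θ :=
        sum_le_sum_of_subset_of_nonneg hS fun a _ _ => sectorWeightCirc_nonneg _ _ _
    _ = 1 := sum_sectorWeightCirc_eq_one n θ

/-- **`|Z| ≤ 1`** for index sets inside one period. [folklore] -/
theorem abs_fatAngular_le_one (hS₁ : S₁ ⊆ range (sectorCount n)) (hS₂ : S₂ ⊆ range (sectorCount n)) (p : Fin 2 → ℝ) : |Z p| ≤ 1 := by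
  rw [hZ]
  have hg : ∀ t : ℝ, 0 ≤ gnCutoff ((π + z) ^ 2 / π ^ 2) ((π + z) ^ 2) t ∧ gnCutoff ((π + z) ^ 2 / π ^ 2) ((π + z) ^ 2) t ≤ 1 :=
    fun t => ⟨(gnCutoff_mem_Icc _ _ t).1, (gnCutoff_mem_Icc _ _ t).2⟩
  have hR : 0 ≤ radialCutoffC (1 / 2) (momToComplex p) ∧ radialCutoffC (1 / 2) (momToComplex p) ≤ 1 :=
    ⟨(radialCutoffC_mem_Icc _ _).1, (radialCutoffC_mem_Icc _ _).2⟩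
  have hA : ∀ {S : Finset ℕ}, S ⊆ range (sectorCount n) →
      0 ≤ radialCutoffC (1 / 2) (momToComplex p) * ∑ a ∈ S, sectorWeightCirc n ((a : ℕ) : ℤ) (polarAngle p) ∧
      radialCutoffC (1 / 2) (momToComplex p) * ∑ a ∈ S, sectorWeightCirc n ((a : ℕ) : ℤ) (polarAngle p) ≤ 1 := fun hS =>
    ⟨mul_nonneg hR.1 (sum_sectorWeightCirc_sub_mem hS _).1,
      mul_le_one₀ hR.2 (sum_sectorWeightCirc_sub_mem hS _).1 (sum_sectorWeightCirc_sub_mem hS _).2⟩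
  rw [abs_le]
  constructor
  · have : 0 ≤ gnCutoff ((π + z) ^ 2 / π ^ 2) ((π + z) ^ 2) (p 0 ^ 2) * gnCutoff ((π + z) ^ 2 / π ^ 2) ((π + z) ^ 2) (p 1 ^ 2) *
        ((radialCutoffC (1 / 2) (momToComplex p) * ∑ a ∈ S₁, sectorWeightCirc n ((a : ℕ) : ℤ) (polarAngle p)) *
          (radialCutoffC (1 / 2) (momToComplex p) * ∑ b ∈ S₂, sectorWeightCirc n ((b : ℕ) : ℤ) (polarAngle p))) :=
      mul_nonneg (mul_nonneg (hg _).1 (hg _).1) (mul_nonneg (hA hS₁).1 (hA hS₂).1)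
    linarith
  · exact mul_le_one₀ (mul_le_one₀ (hg _).2 (hg _).1 (hg _).2) (mul_nonneg (hA hS₁).1 (hA hS₂).1)
      (mul_le_one₀ (hA hS₁).2 (hA hS₂).1 (hA hS₂).2)

/-- **Support**: `Z(p) ≠ 0 ⇒` some `ζ̃_{n,a}(θ(p)) ≠ 0` with `a ∈ S₁`, and some `ζ̃_{n,b}(θ(p)) ≠ 0` with `b ∈ S₂`. [folklore] -/
theorem fatAngular_support {p : Fin 2 → ℝ} (h : Z p ≠ 0) :
    (∃ a ∈ S₁, sectorWeightCirc n ((a : ℕ) : ℤ) (polarAngle p) ≠ 0) ∧ (∃ b ∈ S₂, sectorWeightCirc n ((b : ℕ) : ℤ) (polarAngle p) ≠ 0) := by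
  rw [hZ] at h
  obtain ⟨-, h2⟩ := mul_ne_zero_iff.1 h
  obtain ⟨hA, hB⟩ := mul_ne_zero_iff.1 h2
  exact ⟨exists_ne_zero_of_sum_ne_zero (mul_ne_zero_iff.1 hA).2, exists_ne_zero_of_sum_ne_zero (mul_ne_zero_iff.1 hB).2⟩

/-- **Zone and support together**: `Z(p) ≠ 0` forces `|p_j| < π + z` for both `j` (`z > 0`) — the contrapositive of the zone
statement, in the form the fat frame instance uses. [folklore] -/
theorem abs_lt_of_fatAngular_ne_zero (hz : 0 < z) {p : Fin 2 → ℝ} (h : Z p ≠ 0) (j : Fin 2) : |p j| < π + z := by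
  by_contra hge
  push Not at hge
  have hπz : 0 ≤ π + z := by linarith [Real.pi_pos]
  have hsq : (π + z) ^ 2 ≤ p j ^ 2 := by
    rw [← sq_abs (p j)]; exact pow_le_pow_left₀ hπz hge 2
  apply h
  rw [hZ]
  fin_cases j
  · rw [sqCutoff_eq_zero hz (by simpa using hsq)]; ring
  · rw [mul_comm (gnCutoff _ _ (p 0 ^ 2)), sqCutoff_eq_zero hz (by simpa using hsq)]; ring

/-- **Line derivatives of the fat angular factor** at a point `p₀ + s•w` of the open square with `‖·‖ ≥ 1`:
`|∂ₛZ| ≤ |S₁||S₂|·4B·D` and `|∂ₛ²Z| ≤ |S₁||S₂|·(4B·D² + 8B²·D²)`, `D = (1 + 2/w_n)‖w₁ + iw₂‖`.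
[cite: BenfattoGiulianiMastropietro2006, §2.5 Lemma 2.2, §2.7 (2.71a)] -/
theorem abs_derivs_fatAngular_line_le (hz : 0 < z) {B : ℝ} (hB0 : 0 ≤ B)
    (hB : ∀ (i : ℕ), i ≤ 2 → ∀ (n : ℕ) (ω : ℤ) (θ₀ : ℝ) (q w : Fin 2 → ℝ) (t : ℝ) {r₀ : ℝ}, 0 < r₀ →
      r₀ ≤ ‖momToComplex (q + t • w)‖ → |sectorRelAngle θ₀ (q + t • w)| < π →
      ‖iteratedDeriv i (fun t : ℝ => sectorWeightCirc n ω (polarAngle (q + t • w))) t‖ ≤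
        (2 : ℕ)! * B * ((1 + (sectorWidth n)⁻¹ * (2 : ℕ)!) * ‖momToComplex w‖ / r₀) ^ i)
    (p₀ w : Fin 2 → ℝ) {s : ℝ} (hsq : ∀ i, |(p₀ + s • w) i| < π) (hfermi : 1 ≤ ‖momToComplex (p₀ + s • w)‖) :
    |deriv (fun σ : ℝ => Z (p₀ + σ • w)) s| ≤
        (S₁.card * S₂.card : ℝ) * (4 * B * ((1 + 2 * (sectorWidth n)⁻¹) * ‖momToComplex w‖)) ∧
      |iteratedDeriv 2 (fun σ : ℝ => Z (p₀ + σ • w)) s| ≤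
        (S₁.card * S₂.card : ℝ) * (4 * B * ((1 + 2 * (sectorWidth n)⁻¹) * ‖momToComplex w‖) ^ 2 +
          8 * B ^ 2 * ((1 + 2 * (sectorWidth n)⁻¹) * ‖momToComplex w‖) ^ 2) := by
  set D : ℝ := (1 + 2 * (sectorWidth n)⁻¹) * ‖momToComplex w‖ with hD
  -- the summands along the line
  set g : ℕ → ℕ → ℝ → ℝ := fun a b σ =>
    gnCutoff ((π + z) ^ 2 / π ^ 2) ((π + z) ^ 2) ((p₀ + σ • w) 0 ^ 2) * gnCutoff ((π + z) ^ 2 / π ^ 2) ((π + z) ^ 2) ((p₀ + σ • w) 1 ^ 2) *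
      ((radialCutoffC (1 / 2) (momToComplex (p₀ + σ • w)) * sectorWeightCirc n ((a : ℕ) : ℤ) (polarAngle (p₀ + σ • w))) *
        (radialCutoffC (1 / 2) (momToComplex (p₀ + σ • w)) * sectorWeightCirc n ((b : ℕ) : ℤ) (polarAngle (p₀ + σ • w))))
    with hg
  have hline : (fun σ : ℝ => Z (p₀ + σ • w)) = fun σ => ∑ a ∈ S₁, ∑ b ∈ S₂, g a b σ := by
    funext σ; rw [fatAngular_eq_sum hZ]
  -- each summand is the two-sector angular factor along the line: smooth, with the p4 bounds
  have hsm : ∀ a b, ContDiff ℝ 2 (g a b) := by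
    intro a b
    have hc := contDiff_angularFactor (n₁ := n) (n₂ := n) (ω₁ := ((a : ℕ) : ℤ)) (ω₂ := ((b : ℕ) : ℤ)) (z := z) (m := 2)
      (Z := fun p => gnCutoff ((π + z) ^ 2 / π ^ 2) ((π + z) ^ 2) (p 0 ^ 2) * gnCutoff ((π + z) ^ 2 / π ^ 2) ((π + z) ^ 2) (p 1 ^ 2) *
        ((radialCutoffC (1 / 2) (momToComplex p) * sectorWeightCirc n ((a : ℕ) : ℤ) (polarAngle p)) *
          (radialCutoffC (1 / 2) (momToComplex p) * sectorWeightCirc n ((b : ℕ) : ℤ) (polarAngle p)))) (fun _ => rfl)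
    exact hc.comp (contDiff_const.add (contDiff_id.smul contDiff_const))
  have hbd : ∀ a b, |deriv (g a b) s| ≤ 2 * B * (D + D) ∧ |iteratedDeriv 2 (g a b) s| ≤ 2 * B * (D ^ 2 + D ^ 2) + 8 * B ^ 2 * (D * D) := by
    intro a b
    exact abs_derivs_angularFactor_line_le hz (n₁ := n) (n₂ := n) (ω₁ := ((a : ℕ) : ℤ)) (ω₂ := ((b : ℕ) : ℤ))
      (Z := fun p => gnCutoff ((π + z) ^ 2 / π ^ 2) ((π + z) ^ 2) (p 0 ^ 2) * gnCutoff ((π + z) ^ 2 / π ^ 2) ((π + z) ^ 2) (p 1 ^ 2) *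
        ((radialCutoffC (1 / 2) (momToComplex p) * sectorWeightCirc n ((a : ℕ) : ℤ) (polarAngle p)) *
          (radialCutoffC (1 / 2) (momToComplex p) * sectorWeightCirc n ((b : ℕ) : ℤ) (polarAngle p)))) (fun _ => rfl)
      hB0 hB p₀ w hsq hfermi
  rw [hline]
  constructor
  · rw [deriv_fun_sum fun a _ => ?_]
    · calc |∑ a ∈ S₁, deriv (fun σ => ∑ b ∈ S₂, g a b σ) s| ≤ ∑ a ∈ S₁, |deriv (fun σ => ∑ b ∈ S₂, g a b σ) s| :=
            abs_sum_le_sum_abs _ _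
        _ ≤ ∑ a ∈ S₁, ∑ b ∈ S₂, 2 * B * (D + D) := by
            refine sum_le_sum fun a _ => ?_
            rw [deriv_fun_sum fun b _ => ((hsm a b).differentiable (by norm_num)) s]
            exact (abs_sum_le_sum_abs _ _).trans (sum_le_sum fun b _ => (hbd a b).1)
        _ = (S₁.card * S₂.card : ℝ) * (4 * B * D) := by
            rw [sum_const, sum_const, nsmul_eq_mul, nsmul_eq_mul]; ring
    · exact DifferentiableAt.fun_sum fun b _ => ((hsm a b).differentiable (by norm_num)) s
  · rw [iteratedDeriv_fun_sum fun a _ => ?_]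
    · calc |∑ a ∈ S₁, iteratedDeriv 2 (fun σ => ∑ b ∈ S₂, g a b σ) s| ≤ ∑ a ∈ S₁, |iteratedDeriv 2 (fun σ => ∑ b ∈ S₂, g a b σ) s| :=
            abs_sum_le_sum_abs _ _
        _ ≤ ∑ a ∈ S₁, ∑ b ∈ S₂, (2 * B * (D ^ 2 + D ^ 2) + 8 * B ^ 2 * (D * D)) := by
            refine sum_le_sum fun a _ => ?_
            rw [iteratedDeriv_fun_sum fun b _ => (hsm a b).contDiffAt]
            exact (abs_sum_le_sum_abs _ _).trans (sum_le_sum fun b _ => (hbd a b).2)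
        _ = (S₁.card * S₂.card : ℝ) * (4 * B * D ^ 2 + 8 * B ^ 2 * D ^ 2) := by
            rw [sum_const, sum_const, nsmul_eq_mul, nsmul_eq_mul]; ring
    · exact (ContDiff.sum fun b _ => hsm a b).contDiffAt

end Fat

end Summit.HubbardSuperconductivity.HubbardSuperconductivity.Theorems.TorusFourierL2

end
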